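import Summits.CriticalPhenomena.CardyFormulaZ2.Theorems.CardyAnchoredRigidityCardyShadowIsolatedDilationDynamicsGlue
import Summits.CriticalPhenomena.CardyFormulaZ2.Theorems.CardySelfRefinementScaleInvariantLimitsStubLagsOfScaleInvariantLimits
import Literature.Probability.Percolation.QuadCrossingContinuityEventsDischarge
import Literature.Probability.Percolation.QuadCrossingContinuityOfLemma51
import Literature.Probability.Percolation.QuadCrossingPathCrossings
import Literature.Probability.Percolation.QuadCrossingRotationInvarianceOfSS
import HarnessLib

/-!
# Stub D of `CardyShadowIsolated` (line `dilation-dynamics`): `ScaleInvariantLimits` → dictionary → D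

Crux `Summit.CriticalPhenomena.CardyFormulaZ2.Theses.CardyLocalRigidity.CardyShadowIsolated`
(stmt-CriticalPhenomena-5767), registered stub D `stub_cardyUnstableTrivial` (a cluster point
`g' ∈ Λ' = clusterSet` of `δ ↦ (R ↦ bondDomainCrossingProb R δ)` whose dilates converge to the
Cardy shadow as `s → -∞` is the Cardy shadow).  D is open; the nearest sufficient open item is the
auto-crux `X = CardySelfRefinement.ScaleInvariantLimits` (stmt-CriticalPhenomena-10265: every
subsequential limit of the bond-`ℤ²` QUAD-crossing laws in `ℋ_ℂ` is dilation invariant).  This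
file makes `X ⇒ D` a tree theorem modulo ONE hypothesis, the rectangle ↔ quad DICTIONARY, and
reduces that dictionary to deterministic geometry.

* `tendsto_quadCrossingProb_sub_z2QuadLaw_crossedEvent` (unconditional): for a quad `Q` of `R`
  (`[Q] = closure R.carrier`, `∂₀Q = R.arc 0`, `∂₂Q = R.arc 2`; `squareModelQuad` of a square
  model, `exists_isSquareModel`), DKKMO's `quadCrossingProb δ R` and the Schramm–Smirnov marginal
  `μ_δ(⊞_Q)` merge as `δ → 0⁺` (sandwich `{Q₁ ∈ S_ω} ⊆ 𝒞_δ(R) ⊆ {Q ∈ S_ω}` of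
  `QuadCrossingPathCrossings` + the continuity estimate (5.1), `Quad.continuity_of_lemma_5_1`,
  from the DISCHARGED `SchrammSmirnov2011_lemma_5_1_holds`).
* `tendsto_quadCrossingProb_mul_sub_of_scaleInvariantLimits`: `X ⇒ quadCrossingProb (kδ) R -
  quadCrossingProb δ R → 0` for every `R`, `k > 1` (`stub_lags_of_scaleInvariantLimits`).
* `stub_cardyUnstableTrivial_of_scaleInvariantLimits_of_dict` (registered): `X → Dict → D` with
  `Dict := ∀ R, bondDomainCrossingProb R δ - quadCrossingProb δ R → 0` (G02's discrete-arc
  crossing of the discretised domain vs DKKMO's continuum crossing of the closed quad, same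
  lattice, same `P_{1/2}`; flagged OPEN, not a definition, in the headers of
  `QuadCrossingSpaceZ2.lean` / `QuadCrossingRotationInvariance.lean`; no tree declaration, taken
  verbatim).  Given it every lag `k > 1` of `bondDomainCrossingProb` merges, so `Λ'` is pointwise
  fixed by every dilation (`scaleAct_eq_self_of_scaleInvariantLimits_of_dict`) and D follows.
* `tendsto_bondDomainCrossingProb_sub_quadCrossingProb_of_sandwich` and the finer registered
  bridge `stub_cardyUnstableTrivial_of_scaleInvariantLimits_of_sandwich`: by (5.1) the
  dictionary reduces to two DETERMINISTIC sample-wise inclusions between the G02 event and the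
  raw crossings of Schramm–Smirnov's perturbations `F.Qm t < Q₀ < F.Qp t` of a quad of `R`.
-/

noncomputable section

namespace Summit.CriticalPhenomena.CardyFormulaZ2.Theorems.CardyShadowIsolated.DilationDynamics

open Set Filter Topology MeasureTheory
open scoped ENNReal
open Literature.Probability.RandomPlanarGeometry Literature.Probability.Percolation
open Literature.Probability.Percolation.QuadCrossing Literature.Probability.LatticeModels

/-- Multiplication by a positive constant maps `𝓝[>] 0` to `𝓝[>] 0`. [folklore] -/
theorem tendsto_const_mul_nhdsWithin_Ioi_zero {c : ℝ} (hc : 0 < c) :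
    Tendsto (fun δ : ℝ => c * δ) (𝓝[>] (0 : ℝ)) (𝓝[>] (0 : ℝ)) := by
  refine tendsto_nhdsWithin_of_tendsto_nhds_of_eventually_within _ ?_ ?_
  · have h : Tendsto (fun δ : ℝ => c * δ) (𝓝 0) (𝓝 (c * 0)) :=
      (continuous_const.mul continuous_id).tendsto 0
    exact (mul_zero c ▸ h).mono_left nhdsWithin_le_nhds
  · filter_upwards [self_mem_nhdsWithin] with δ hδ using mul_pos hc hδ

/-! ### The DKKMO ↔ Schramm–Smirnov dictionary (unconditional) -/

/-- **DKKMO's `quadCrossingProb δ R` and the Schramm–Smirnov marginal `μ_δ(⊞_Q)` of a quad `Q`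
of `R` merge as `δ → 0⁺`.**  Given `ε`, (5.1) (`Quad.continuity_of_lemma_5_1`, Lemma 5.1
discharged) gives `Q' < Q < Q''`, `δ₀` with `P[Q' raw-crossed ∧ Q'' not] ≤ ε/2` for `δ < δ₀`;
with `Q < Q₁ < Q''` one has `{Q₁ ∈ S_ω} ⊆ 𝒞_δ(R) ⊆ {Q ∈ S_ω}` (`QuadCrossingPathCrossings`) and
`{Q ∈ S_ω} ∖ {Q₁ ∈ S_ω} ⊆ {Q' raw-crossed ∧ Q'' not}` (lower sets), whence
`|quadCrossingProb δ R - μ_δ(⊞_Q)| ≤ ε/2`. [cite: SchrammSmirnov2011, §1.3 and Lemma 5.1, eq. (5.1)] -/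
theorem tendsto_quadCrossingProb_sub_z2QuadLaw_crossedEvent {R : ConformalRectangle}
    {Q : Quad (univ : Set ℂ)} (hc : Q.carrier = closure R.carrier) (h0 : Q.side 0 = R.arc 0)
    (h2 : Q.side 2 = R.arc 2) :
    Tendsto (fun δ : ℝ => quadCrossingProb δ R -
        (z2QuadLaw univ δ : Measure (QuadCrossingSpace (univ : Set ℂ))).real
          (QuadConfig.crossedEvent Q)) (𝓝[>] (0 : ℝ)) (𝓝 0) := by
  rw [Metric.tendsto_nhdsWithin_nhds]
  intro ε hε
  have hε2 : (0 : ℝ≥0∞) < ENNReal.ofReal (ε / 2) := ENNReal.ofReal_pos.mpr (half_pos hε)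
  obtain ⟨Q', Q'', hQ'Q, hQQ'', δ₀, hδ₀, hbound⟩ :=
    Quad.continuity_of_lemma_5_1 SchrammSmirnov2011_lemma_5_1_holds Q (ENNReal.ofReal (ε / 2)) hε2
  obtain ⟨Q₁, hQQ₁, hQ₁Q''⟩ := Quad.exists_strictlyDominated_between isOpen_univ hQQ''
  refine ⟨δ₀, hδ₀, fun δ hδmem hδdist => ?_⟩
  have hδ : 0 < δ := hδmem
  have hδlt : δ < δ₀ := by rwa [Real.dist_eq, sub_zero, abs_of_pos hδ] at hδdist
  -- notation
  set P : Measure (BondConfig (Site 2)) := bondPercolation (zdGraph 2) half with hP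
  set A : Set (BondConfig (Site 2)) := {ω | Q ∈ z2QuadConfig univ δ ω} with hA
  set B : Set (BondConfig (Site 2)) := {ω | Q₁ ∈ z2QuadConfig univ δ ω} with hB
  set E : Set (BondConfig (Site 2)) := {ω | (∃ K, Q'.IsCrossing K ∧ K ⊆ openEdgeUnion δ ω) ∧
    ¬ ∃ K, Q''.IsCrossing K ∧ K ⊆ openEdgeUnion δ ω} with hE
  -- the sandwich
  have hBC : B ⊆ quadCrossing R δ := setOf_mem_z2QuadConfig_subset_quadCrossing hc h0 h2 hQQ₁ hδ
  have hCA : quadCrossing R δ ⊆ A := quadCrossing_subset_setOf_mem_z2QuadConfig hc h0 h2 δ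
  -- the difference lies in the continuity event
  have hAB : A \ B ⊆ E := by
    rintro ω ⟨hωA, hωB⟩
    have hωA' : Q ∈ (z2QuadConfig univ δ ω : Set (Quad (univ : Set ℂ))) := hωA
    rw [coe_z2QuadConfig] at hωA'
    refine ⟨Quad.exists_isCrossing_of_mem_closure hQ'Q hωA', fun ⟨K, hK, hKO⟩ => hωB ?_⟩
    obtain ⟨K₁, hK₁K, hK₁⟩ := hQ₁Q''.dominated K hK
    exact mem_z2QuadConfig_of_isCrossing hK₁ (hK₁K.trans hKO)
  -- measurability
  have hmeas : Measurable (z2QuadConfig (univ : Set ℂ) δ) := measurable_z2QuadConfig isOpen_univ hδ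
  have hBm : MeasurableSet B := hmeas (QuadConfig.measurableSet_crossedEvent Q₁)
  -- the marginal is `P A`
  have hmarg : (z2QuadLaw univ δ : Measure (QuadCrossingSpace (univ : Set ℂ))).real
      (QuadConfig.crossedEvent Q) = P.real A := by
    simp only [measureReal_def]
    rw [z2QuadLaw_apply isOpen_univ hδ (QuadConfig.measurableSet_crossedEvent Q)]
    rfl
  have hqcp : quadCrossingProb δ R = P.real (quadCrossing R δ) := rfl
  -- estimates
  have hPE : P.real E ≤ ε / 2 := by
    have h := hbound δ hδ hδlt
    have h' : (P E).toReal ≤ (ENNReal.ofReal (ε / 2)).toReal :=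
      ENNReal.toReal_mono ENNReal.ofReal_ne_top h
    rwa [ENNReal.toReal_ofReal (half_pos hε).le] at h'
  have hdiff : P.real A - P.real B = P.real (A \ B) :=
    (measureReal_sdiff (hB ▸ fun ω hω => hCA (hBC hω)) hBm).symm
  have h1 : P.real B ≤ P.real (quadCrossing R δ) := measureReal_mono hBC
  have h2 : P.real (quadCrossing R δ) ≤ P.real A := measureReal_mono hCA
  have h3 : P.real (A \ B) ≤ P.real E := measureReal_mono hAB
  rw [Real.dist_eq, sub_zero, hmarg, hqcp, abs_sub_lt_iff]
  constructor <;> linarith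

/-- **Lag merging of the one-quad marginals from `X`**: `μ_{kδ}(⊞_Q) - μ_δ(⊞_Q) → 0` (`k > 1`;
`stub_lags_of_scaleInvariantLimits` at the family `![Q]`, Lemma 5.1 discharged,
`squareCrossingLaw D η = z2QuadLaw D (η √2)`). [cite: SchrammSmirnov2011, Cor. 5.2] -/
theorem tendsto_z2QuadLaw_crossedEvent_mul_sub_of_scaleInvariantLimits
    (hX : Summit.CriticalPhenomena.CardyFormulaZ2.Theses.CardySelfRefinement.ScaleInvariantLimits)
    (Q : Quad (univ : Set ℂ)) {k : ℝ} (hk : 1 < k) :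
    Tendsto (fun δ : ℝ =>
      (z2QuadLaw univ (k * δ) : Measure (QuadCrossingSpace (univ : Set ℂ))).real
          (QuadConfig.crossedEvent Q) -
        (z2QuadLaw univ δ : Measure (QuadCrossingSpace (univ : Set ℂ))).real
          (QuadConfig.crossedEvent Q)) (𝓝[>] (0 : ℝ)) (𝓝 0) := by
  have h2 : (0 : ℝ) < Real.sqrt 2 := Real.sqrt_pos.mpr two_pos
  have hlag := Summit.CriticalPhenomena.CardyFormulaZ2.Theorems.stub_lags_of_scaleInvariantLimits
    SchrammSmirnov2011_lemma_5_1_holds hX k hk 1 (fun _ => Q)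
  have hev : {S : QuadConfig (univ : Set ℂ) | ∀ _i : Fin 1, Q ∈ S} = QuadConfig.crossedEvent Q := by
    ext S
    simp only [mem_setOf_eq, QuadConfig.mem_crossedEvent, forall_const]
  simp only [hev, squareCrossingLaw_eq_z2QuadLaw] at hlag
  have hcomp := hlag.comp (tendsto_const_mul_nhdsWithin_Ioi_zero (inv_pos.mpr h2))
  have hfun : ∀ δ : ℝ, (Real.sqrt 2)⁻¹ * δ * Real.sqrt 2 = δ := fun δ => by
    field_simp
  refine hcomp.congr fun δ => ?_
  simp only [Function.comp_apply, mul_assoc k, hfun]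

/-- **`X` ⇒ `quadCrossingProb (k δ) R - quadCrossingProb δ R → 0`** for every `R` and `k > 1`
(the marginals of a quad of `R` merge and both probabilities are within `o(1)` of them).
[cite: SchrammSmirnov2011, Lemma 5.1 and Cor. 5.2] -/
theorem tendsto_quadCrossingProb_mul_sub_of_scaleInvariantLimits
    (hX : Summit.CriticalPhenomena.CardyFormulaZ2.Theses.CardySelfRefinement.ScaleInvariantLimits)
    (R : ConformalRectangle) {k : ℝ} (hk : 1 < k) :
    Tendsto (fun δ : ℝ => quadCrossingProb (k * δ) R - quadCrossingProb δ R)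
      (𝓝[>] (0 : ℝ)) (𝓝 0) := by
  obtain ⟨Φ, hΦ⟩ := exists_isSquareModel R
  have hk0 : 0 < k := one_pos.trans hk
  set m : ℝ → ℝ := fun δ =>
    (z2QuadLaw univ δ : Measure (QuadCrossingSpace (univ : Set ℂ))).real
      (QuadConfig.crossedEvent (squareModelQuad Φ)) with hm
  have hA : Tendsto (fun δ : ℝ => quadCrossingProb δ R - m δ) (𝓝[>] (0 : ℝ)) (𝓝 0) :=
    tendsto_quadCrossingProb_sub_z2QuadLaw_crossedEvent hΦ.carrier_squareModelQuad
      hΦ.side_zero_squareModelQuad hΦ.side_two_squareModelQuad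
  have hAk : Tendsto (fun δ : ℝ => quadCrossingProb (k * δ) R - m (k * δ)) (𝓝[>] (0 : ℝ)) (𝓝 0) :=
    hA.comp (tendsto_const_mul_nhdsWithin_Ioi_zero hk0)
  have hB : Tendsto (fun δ : ℝ => m (k * δ) - m δ) (𝓝[>] (0 : ℝ)) (𝓝 0) :=
    tendsto_z2QuadLaw_crossedEvent_mul_sub_of_scaleInvariantLimits hX (squareModelQuad Φ) hk
  have h := (hAk.add hB).sub hA
  rw [add_zero, sub_zero] at h
  refine h.congr fun δ => ?_
  ring

/-- **The dictionary from a sample-wise sandwich.**  Let `Q₀` be a quad of `R` with a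
perturbation family `F` (`F.Qm t < Q₀ < F.Qp t`, Schramm–Smirnov's narrower/taller and
wider/shorter perturbations).  If for every small `t > 0`, eventually as `δ → 0⁺`, (a) every G02
crossing (`discreteCrossing R.carrier δ (R.arc 0) (R.arc 2)`: open path of `Ω_δ` between the
discrete arcs) makes `F.Qm t` crossed inside the open edges and (b) every crossing of `F.Qp t`
inside the open edges yields a G02 crossing, then `bondDomainCrossingProb R δ - quadCrossingProb δ R
→ 0`: both events lie between `{Qp t raw-crossed} ⊆ {Qm t raw-crossed}`, a sandwich of
probability width `≤ ε` by (5.1) with `Q' < Qm t`, `Qp t < Q''`.  (a), (b) are deterministic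
statements about the discretisation: the remaining content of the dictionary.
[cite: SchrammSmirnov2011, Lemma 5.1 and eq. (5.1)] -/
theorem tendsto_bondDomainCrossingProb_sub_quadCrossingProb_of_sandwich {R : ConformalRectangle}
    {Q₀ : Quad (univ : Set ℂ)} (hc : Q₀.carrier = closure R.carrier) (h0 : Q₀.side 0 = R.arc 0)
    (h2 : Q₀.side 2 = R.arc 2) (F : Quad.PerturbFamily Q₀)
    (hsand : ∀ t : ℝ, 0 < t → t ≤ F.t₀ →
      (∀ᶠ δ in 𝓝[>] (0 : ℝ), discreteCrossing R.carrier δ (R.arc 0) (R.arc 2) ⊆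
          {ω | ∃ K, (F.Qm t).IsCrossing K ∧ K ⊆ openEdgeUnion δ ω}) ∧
      (∀ᶠ δ in 𝓝[>] (0 : ℝ), {ω | ∃ K, (F.Qp t).IsCrossing K ∧ K ⊆ openEdgeUnion δ ω} ⊆
          discreteCrossing R.carrier δ (R.arc 0) (R.arc 2))) :
    Tendsto (fun δ : ℝ => bondDomainCrossingProb R δ - quadCrossingProb δ R)
      (𝓝[>] (0 : ℝ)) (𝓝 0) := by
  rw [Metric.tendsto_nhds]
  intro ε hε
  have hε2 : (0 : ℝ≥0∞) < ENNReal.ofReal (ε / 2) := ENNReal.ofReal_pos.mpr (half_pos hε)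
  obtain ⟨Q', Q'', hQ'Q, hQQ'', δ₀, hδ₀, hbound⟩ :=
    Quad.continuity_of_lemma_5_1 SchrammSmirnov2011_lemma_5_1_holds Q₀ (ENNReal.ofReal (ε / 2)) hε2
  -- a level `t = F.seq n` with `Q' < Qm t` and `Qp t < Q''`
  have hm : ∀ᶠ n in atTop, Quad.StrictlyDominated Q' (F.Qm (F.seq n)) := by
    obtain ⟨U₁, U₂, hU₁, hU₂, h₁, h₂', hdom⟩ := Quad.strictlyDominated_iff.1 hQ'Q
    filter_upwards [F.tendsto_Qm_seq (hU₂.mem_nhds h₂')] with n hn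
    exact Quad.strictlyDominated_iff.2 ⟨U₁, U₂, hU₁, hU₂, h₁, hn, hdom⟩
  obtain ⟨n, hn₁, hn₂⟩ := (hm.and (F.eventually_Qp_seq_lt hQQ'')).exists
  set t : ℝ := (F.seq n : ℝ) with ht
  obtain ⟨hA, hB⟩ := hsand t (F.seq_pos n) (F.seq_le n)
  have hδ₀ev : ∀ᶠ δ in 𝓝[>] (0 : ℝ), δ < δ₀ := mem_nhdsWithin_of_mem_nhds (Iio_mem_nhds hδ₀)
  filter_upwards [hA, hB, hδ₀ev, self_mem_nhdsWithin] with δ hAδ hBδ hδlt hδpos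
  have hδ : 0 < δ := hδpos
  -- notation
  set P : Measure (BondConfig (Site 2)) := bondPercolation (zdGraph 2) half with hP
  set G : Set (BondConfig (Site 2)) := discreteCrossing R.carrier δ (R.arc 0) (R.arc 2) with hG
  set C : Set (BondConfig (Site 2)) := quadCrossing R δ with hC
  set RM : Set (BondConfig (Site 2)) := {ω | ∃ K, (F.Qm t).IsCrossing K ∧ K ⊆ openEdgeUnion δ ω}
  set RP : Set (BondConfig (Site 2)) := {ω | ∃ K, (F.Qp t).IsCrossing K ∧ K ⊆ openEdgeUnion δ ω}
  set E : Set (BondConfig (Site 2)) := {ω | (∃ K, Q'.IsCrossing K ∧ K ⊆ openEdgeUnion δ ω) ∧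
    ¬ ∃ K, Q''.IsCrossing K ∧ K ⊆ openEdgeUnion δ ω} with hE
  have hQmQ : Quad.StrictlyDominated (F.Qm t) Q₀ := F.Qm_lt (F.seq_pos n) (F.seq_le n)
  have hQQp : Quad.StrictlyDominated Q₀ (F.Qp t) := F.lt_Qp (F.seq_pos n) (F.seq_le n)
  -- DKKMO's event is sandwiched too
  have hRPC : RP ⊆ C := fun ω ⟨K, hK, hKO⟩ =>
    setOf_mem_z2QuadConfig_subset_quadCrossing hc h0 h2 hQQp hδ (mem_z2QuadConfig_of_isCrossing hK hKO)
  have hCRM : C ⊆ RM := by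
    intro ω hω
    have hωA : Q₀ ∈ (z2QuadConfig univ δ ω : Set (Quad (univ : Set ℂ))) :=
      quadCrossing_subset_setOf_mem_z2QuadConfig hc h0 h2 δ hω
    rw [coe_z2QuadConfig] at hωA
    exact Quad.exists_isCrossing_of_mem_closure hQmQ hωA
  -- the sandwich has width `≤ ε / 2`
  have hRMsub : RM ⊆ (RM \ RP) ∪ RP := fun ω hω =>
    (em (ω ∈ RP)).elim Or.inr fun h => Or.inl ⟨hω, h⟩
  have hdiffE : RM \ RP ⊆ E := by
    rintro ω ⟨⟨K, hK, hKO⟩, hωP⟩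
    refine ⟨?_, fun ⟨K'', hK'', hK''O⟩ => hωP ?_⟩
    · obtain ⟨K₁, hK₁K, hK₁⟩ := hn₁.dominated K hK
      exact ⟨K₁, hK₁, hK₁K.trans hKO⟩
    · obtain ⟨K₁, hK₁K, hK₁⟩ := hn₂.dominated K'' hK''
      exact ⟨K₁, hK₁, hK₁K.trans hK''O⟩
  have hPE : P.real E ≤ ε / 2 := by
    have h := hbound δ hδ hδlt
    have h' : (P E).toReal ≤ (ENNReal.ofReal (ε / 2)).toReal :=
      ENNReal.toReal_mono ENNReal.ofReal_ne_top h
    rwa [ENNReal.toReal_ofReal (half_pos hε).le] at h'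
  have hdiffE' : P.real (RM \ RP) ≤ P.real E := measureReal_mono hdiffE
  have hwidth : P.real RM ≤ P.real RP + ε / 2 :=
    calc P.real RM ≤ P.real ((RM \ RP) ∪ RP) := measureReal_mono hRMsub
      _ ≤ P.real (RM \ RP) + P.real RP := measureReal_union_le _ _
      _ ≤ P.real RP + ε / 2 := by linarith
  have hG1 : P.real G ≤ P.real RM := measureReal_mono hAδ
  have hG2 : P.real RP ≤ P.real G := measureReal_mono hBδ
  have hC1 : P.real C ≤ P.real RM := measureReal_mono hCRM
  have hC2 : P.real RP ≤ P.real C := measureReal_mono hRPC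
  have hbd : bondDomainCrossingProb R δ = P.real G := rfl
  have hqc : quadCrossingProb δ R = P.real C := rfl
  rw [Real.dist_eq, sub_zero, hbd, hqc, abs_sub_lt_iff]
  constructor <;> linarith

/-! ### The bridge: `X` and the rectangle ↔ quad dictionary ⇒ `Λ'` is scale-fixed ⇒ D -/

/-- **`X` + dictionary ⇒ every cluster point is fixed by every dilation.**  Under
`ScaleInvariantLimits` and the dictionary `bondDomainCrossingProb R δ - quadCrossingProb δ R → 0`
(every `R`), EVERY lag `k > 1` of `bondDomainCrossingProb` merges (the dictionary at meshes `δ/k`,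
`δ` around `tendsto_quadCrossingProb_mul_sub_of_scaleInvariantLimits`), so each `g ∈ Λ'` is fixed
by `scaleAct (log k)`, `k > 1` (the one-lag step: `f ↦ f(e^{log k} R) − f(R)` is continuous on
the product space, `P_δ(e^{log k} R) = P_{δ/k}(R)` exactly by `bondDomainCrossingProb_map_dilation`,
and a cluster value of a null function is `0` — the argument of
`…CardyShadowIsolated.LagInvariance.scaleAct_log_eq_self_of_lag`, inlined), i.e. by `scaleAct s`,
`s > 0`, hence by all (`scaleAct_add`, `scaleAct_zero`). [cite: SchrammSmirnov2011, §1] -/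
theorem scaleAct_eq_self_of_scaleInvariantLimits_of_dict
    (hX : Summit.CriticalPhenomena.CardyFormulaZ2.Theses.CardySelfRefinement.ScaleInvariantLimits)
    (hDict : ∀ R : ConformalRectangle,
      Tendsto (fun δ : ℝ => bondDomainCrossingProb R δ - quadCrossingProb δ R)
        (nhdsWithin (0 : ℝ) (Set.Ioi 0)) (𝓝 0)) :
    ∀ g ∈ clusterSet, ∀ s : ℝ, scaleAct s g = g := by
  -- lag merging of `bondDomainCrossingProb` at every lag `k > 1`
  have hlag : ∀ {k : ℝ}, 1 < k → ∀ R : ConformalRectangle,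
      Tendsto (fun δ : ℝ => bondDomainCrossingProb R (δ / k) - bondDomainCrossingProb R δ)
        (nhdsWithin (0 : ℝ) (Set.Ioi 0)) (𝓝 0) := by
    intro k hk R
    have hk0 : 0 < k := one_pos.trans hk
    have hdiv : Tendsto (fun δ : ℝ => k⁻¹ * δ) (𝓝[>] (0 : ℝ)) (𝓝[>] (0 : ℝ)) :=
      tendsto_const_mul_nhdsWithin_Ioi_zero (inv_pos.mpr hk0)
    have h1 : Tendsto (fun δ : ℝ =>
        bondDomainCrossingProb R (k⁻¹ * δ) - quadCrossingProb (k⁻¹ * δ) R)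
        (𝓝[>] (0 : ℝ)) (𝓝 0) := (hDict R).comp hdiv
    have h2 : Tendsto (fun δ : ℝ =>
        quadCrossingProb (k * (k⁻¹ * δ)) R - quadCrossingProb (k⁻¹ * δ) R)
        (𝓝[>] (0 : ℝ)) (𝓝 0) :=
      (tendsto_quadCrossingProb_mul_sub_of_scaleInvariantLimits hX R hk).comp hdiv
    have h := (h1.sub h2).sub (hDict R)
    rw [sub_zero, sub_zero] at h
    refine h.congr fun δ => ?_
    rw [mul_inv_cancel_left₀ hk0.ne', inv_mul_eq_div]
    ring
  -- one lag ⇒ one fixed dilation (the argument of `LagInvariance.scaleAct_log_eq_self_of_lag`)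
  have hfix : ∀ {g : ConformalRectangle → ℝ}, g ∈ clusterSet → ∀ {k : ℝ}, 1 < k →
      scaleAct (Real.log k) g = g := by
    intro g hg k hk
    have hk0 : 0 < k := one_pos.trans hk
    funext R
    have hg' : MapClusterPt g (nhdsWithin (0 : ℝ) (Set.Ioi 0))
        (fun (δ : ℝ) (R : ConformalRectangle) => bondDomainCrossingProb R δ) := hg
    have hev : Continuous fun f : ConformalRectangle → ℝ => f (R.map (dilation (Real.log k))) - f R :=
      (continuous_apply _).sub (continuous_apply _)
    have h1 := hg'.continuousAt_comp hev.continuousAt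
    have h2 : ((fun f : ConformalRectangle → ℝ => f (R.map (dilation (Real.log k))) - f R) ∘
          fun (δ : ℝ) (R : ConformalRectangle) => bondDomainCrossingProb R δ) =
        fun δ : ℝ => bondDomainCrossingProb R (δ / k) - bondDomainCrossingProb R δ := by
      funext δ
      simp only [Function.comp_apply]
      rw [bondDomainCrossingProb_map_dilation, Real.exp_neg, Real.exp_log hk0, inv_mul_eq_div]
    rw [h2] at h1
    have h3 : g (R.map (dilation (Real.log k))) - g R = 0 :=
      eq_of_nhds_neBot ((h1.clusterPt.mono (hlag hk R)).neBot)
    show g (R.map (dilation (Real.log k))) = g R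
    linarith
  -- every positive time is a fixed dilation
  have hpos : ∀ g ∈ clusterSet, ∀ s : ℝ, 0 < s → scaleAct s g = g := by
    intro g hg s hs
    have h := hfix hg (Real.one_lt_exp_iff.2 hs)
    rwa [Real.log_exp] at h
  intro g hg s
  rcases lt_trichotomy s 0 with hs | rfl | hs
  · have hneg : scaleAct (-s) g = g := hpos g hg (-s) (neg_pos.mpr hs)
    calc scaleAct s g = scaleAct s (scaleAct (-s) g) := by rw [hneg]
      _ = g := by rw [← scaleAct_add, add_neg_cancel, scaleAct_zero]
  · exact scaleAct_zero g
  · exact hpos g hg s hs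

/-- **Registered conditional bridge for stub D** (stmt-CriticalPhenomena-5767):
`ScaleInvariantLimits` (stmt-CriticalPhenomena-10265, verbatim) → the rectangle ↔ quad dictionary
(verbatim over tree vocabulary) → stub D `stub_cardyUnstableTrivial` verbatim (`Λ'` is pointwise
scale-fixed, and a constant orbit converging to the Cardy shadow is the Cardy shadow).  Isolates
the dictionary as the one missing lemma between the auto-crux `X` of route `CardySelfRefinement`
and stub D. [cite: SchrammSmirnov2011, §1 and Lemma 5.1] -/
theorem stub_cardyUnstableTrivial_of_scaleInvariantLimits_of_dict :
    Summit.CriticalPhenomena.CardyFormulaZ2.Theses.CardySelfRefinement.ScaleInvariantLimits →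
    (∀ R : Literature.Probability.RandomPlanarGeometry.ConformalRectangle,
      Filter.Tendsto (fun δ : ℝ => Literature.Probability.Percolation.bondDomainCrossingProb R δ -
        Literature.Probability.Percolation.quadCrossingProb δ R)
        (nhdsWithin (0 : ℝ) (Set.Ioi 0)) (nhds 0)) →
    ∀ g : Literature.Probability.RandomPlanarGeometry.ConformalRectangle → ℝ,
      Summit.CriticalPhenomena.CardyFormulaZ2.Theorems.CardyShadowIsolated.DilationDynamics.IsCardyShadow g →
      ∀ g' ∈ Summit.CriticalPhenomena.CardyFormulaZ2.Theorems.CardyShadowIsolated.DilationDynamics.clusterSet,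
        Filter.Tendsto (fun s : ℝ =>
          Summit.CriticalPhenomena.CardyFormulaZ2.Theorems.CardyShadowIsolated.DilationDynamics.scaleAct s g')
          Filter.atBot (nhds g) → g' = g :=
  fun hX hDict g _ g' hg' ht => by
    have hconst : (fun s : ℝ => scaleAct s g') = fun _ => g' :=
      funext fun s => scaleAct_eq_self_of_scaleInvariantLimits_of_dict hX hDict g' hg' s
    rw [hconst] at ht
    exact tendsto_nhds_unique tendsto_const_nhds ht

/-- **Registered finer bridge for stub D** (stmt-CriticalPhenomena-5767): `ScaleInvariantLimits`
(verbatim) → the SAMPLE-WISE SANDWICH of the G02 event between the raw crossings of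
Schramm–Smirnov's perturbations of a quad of `R` (for every `R`: some square model `Φ`, some
perturbation family `F` of `squareModelQuad Φ`, and for small `t > 0`, eventually in `δ → 0⁺`,
inclusions (a), (b) of `tendsto_bondDomainCrossingProb_sub_quadCrossingProb_of_sandwich`;
deterministic, no tree declaration yet) → stub D verbatim: the previous bridge with the
dictionary discharged down to its two deterministic inclusions. [cite: SchrammSmirnov2011, Lemma 5.1] -/
theorem stub_cardyUnstableTrivial_of_scaleInvariantLimits_of_sandwich :
    Summit.CriticalPhenomena.CardyFormulaZ2.Theses.CardySelfRefinement.ScaleInvariantLimits →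
    (∀ R : Literature.Probability.RandomPlanarGeometry.ConformalRectangle, ∃ Φ : ℂ ≃ₜ ℂ,
      Literature.Probability.Percolation.IsSquareModel R Φ ∧
      ∃ F : Literature.Probability.Percolation.QuadCrossing.Quad.PerturbFamily
          (Literature.Probability.Percolation.squareModelQuad Φ),
        ∀ t : ℝ, 0 < t → t ≤ F.t₀ →
          (∀ᶠ δ in nhdsWithin (0 : ℝ) (Set.Ioi 0),
            Literature.Probability.Percolation.discreteCrossing R.carrier δ (R.arc 0) (R.arc 2) ⊆
              {ω | ∃ K, (F.Qm t).IsCrossing K ∧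
                K ⊆ Literature.Probability.Percolation.openEdgeUnion δ ω}) ∧
          (∀ᶠ δ in nhdsWithin (0 : ℝ) (Set.Ioi 0),
            {ω | ∃ K, (F.Qp t).IsCrossing K ∧
                K ⊆ Literature.Probability.Percolation.openEdgeUnion δ ω} ⊆
              Literature.Probability.Percolation.discreteCrossing R.carrier δ (R.arc 0) (R.arc 2))) →
    ∀ g : Literature.Probability.RandomPlanarGeometry.ConformalRectangle → ℝ,
      Summit.CriticalPhenomena.CardyFormulaZ2.Theorems.CardyShadowIsolated.DilationDynamics.IsCardyShadow g →
      ∀ g' ∈ Summit.CriticalPhenomena.CardyFormulaZ2.Theorems.CardyShadowIsolated.DilationDynamics.clusterSet,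
        Filter.Tendsto (fun s : ℝ =>
          Summit.CriticalPhenomena.CardyFormulaZ2.Theorems.CardyShadowIsolated.DilationDynamics.scaleAct s g')
          Filter.atBot (nhds g) → g' = g := by
  intro hX hsand
  refine stub_cardyUnstableTrivial_of_scaleInvariantLimits_of_dict hX fun R => ?_
  obtain ⟨Φ, hΦ, F, hF⟩ := hsand R
  exact tendsto_bondDomainCrossingProb_sub_quadCrossingProb_of_sandwich hΦ.carrier_squareModelQuad
    hΦ.side_zero_squareModelQuad hΦ.side_two_squareModelQuad F hF

end Summit.CriticalPhenomena.CardyFormulaZ2.Theorems.CardyShadowIsolated.DilationDynamics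

end
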